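import Mathlib
import HarnessLib
import Literature.Computability.AlgebraicComplexity.DegenerationSpectralMonotone
import Summits.MatrixMultiplication.MatrixMultiplication.Theorems.OutsiderSandwichCoreBeatLevel

/-!
# Outsider sandwich — THE BORDER DOOR (I): degeneration certificates for the leaf and the border
# exchange numbers `2^{θ⋆N} ≤ r̲(N) ≤ r(N)` (decomp-mm lens-4 «minimal counterexample / extremal
# reduction», g25)

Beneath the aside leaf `BlockOneIsMM` (item 27147, `⟨2,2,2⟩ ≲ C₁ ⟺ θ⋆ = 0`); the cut of record
(`LaserTangency ∧ LaserMergeOptimal`) is untouched.  Notation of g20–g24: `Helped N B ⟺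
⟨B⟩ ⊠ C₁^{⊠N} ≥ ⟨2,2,2⟩^{⊠N}` (RESTRICTION), `r(N) = exchangeNumber N`, `θ⋆ = exchangeExponent`.

Up to g24 the exchange calculus was restriction-only.  This file opens the border door:

1. **Border certificates.** `HelpedDeg N B :⟺ ⟨B⟩ ⊠ C₁^{⊠N} ⊵ ⟨2,2,2⟩^{⊠N}` as an (algebraic)
   DEGENERATION (BCS (15.19)).  `Helped ⟹ HelpedDeg`; border certificates multiply and pad exactly like
   restriction certificates (`helpedDeg_mul`, `helpedDeg_mono`, `helpedDeg_pow`).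
2. **Same payoff.** Universal spectral points are degeneration-monotone (Strassen 1988, §3; tree
   `IsUniversalSpectralPoint.mono_of_algDegeneratesTo`), so a border certificate bounds every spectral
   ratio exactly as a restriction does: `HelpedDeg N B ⟹ F⟨2,2,2⟩^N ≤ B·F(C₁)^N ⟹ θ⋆ ≤ log₂B / N`
   (`exchangeExponent_le_logb_div_of_helpedDeg`), and conversely it yields RESTRICTION certificates at
   every rate `> log₂B/N` at all large levels (`eventually_helped_of_helpedDeg`): the border door costs
   nothing in rate.  No border certificate has fewer than two helpers (`B = 0`: first gauge point;
   `B = 1`: lens-2's antichain — `⟨2,2,2⟩^{⊠N}` is not even a degeneration of `C₁^{⊠N}`).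
3. **The border exchange numbers** `r̲(N) := min {B | HelpedDeg N B}` satisfy the SAME sandwich as
   `r(N)`: **`2^{θ⋆N} ≤ r̲(N) ≤ r(N) ≤ 2^N`** level by level, `r̲` is submultiplicative, `r̲(0) = 1`,
   `r̲(1) = r̲(2) = 2`, so `θ⋆ = inf_N log₂ r̲(N)/N` as well, and one level with `r̲(N) < 2^{θN}` gives
   `θ⋆ < θ`.
4. **The leaf through the border door.** `BlockOneIsMM ⟺ ∀ θ > 0, ∃ N ≥ 1, r̲(N) ≤ 2^{θN} ⟺` border
   certificates of every positive rate exist; a bounded `r̲` (e.g. `r̲ ≡ 2`) proves the leaf, a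
   counterexample makes `r̲` unbounded.

Sequel (same generation): `OutsiderSandwichBorderCriminal` — the core floor survives the border door,
the border criminal `3 ≤ N̲⋆ ≤ N⋆`, `N̲⋆ = 3 ⟺ HelpedDeg 3 2 ⟹ θ⋆ ≤ 1/3 < 0.37295`.

[Strassen1988, §3, Thm. 3.8]; [BurgisserClausenShokrollahi1997, (15.19)–(15.26)];
[ChristandlVranaZuiddam2023, §1.2, Example 1.4]; [Blaser2013, Thm. 6.3]; [Zuiddam2018, §2.3].
-/

noncomputable section

open Literature.Computability.AlgebraicComplexity
open Summit.MatrixMultiplication.MatrixMultiplication.Theorems.OutsiderSandwichCoupling (coupling₁)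
open Summit.MatrixMultiplication.MatrixMultiplication.Theorems.OutsiderSandwichExchangeRate
open Summit.MatrixMultiplication.MatrixMultiplication.Theorems.OutsiderSandwichExchangeExponent
open Summit.MatrixMultiplication.MatrixMultiplication.Theorems.OutsiderSandwichExchangeSpectral
open Summit.MatrixMultiplication.MatrixMultiplication.Theorems.OutsiderSandwichExchangeLevelTwo
  (exchangeNumber_two)
open Summit.MatrixMultiplication.MatrixMultiplication.Theorems.OutsiderSandwichSymmetricCore
  (symCore coupling₁_restrictsTo_symCore SymHelped flatteningRank_le_card flatteningRank_matMul_two)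
open Summit.MatrixMultiplication.MatrixMultiplication.Theorems.OutsiderSandwichCoreBeatLevel

namespace Summit.MatrixMultiplication.MatrixMultiplication.Theorems.OutsiderSandwichBorderExchange

variable {ι κ μ : Type} [Fintype ι] [Fintype κ] [Fintype μ]

/-! ## 0. Border certificates -/

/-- **`HelpedDegBy H N B`** (problem-side definition): `⟨B⟩ ⊠ H^{⊠N} ⊵ ⟨2,2,2⟩^{⊠N}` as a
DEGENERATION in the sense of BCS (15.19) (tree `AlgDegeneratesTo`) — the border version of g23's
`HelpedBy`. -/
def HelpedDegBy (H : ι → κ → μ → ℂ) (N B : ℕ) : Prop :=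
  AlgDegeneratesTo (kroneckerTensor (unitTensor ℂ B) (kroneckerPow H N))
    (kroneckerPow (matMulTensor ℂ 2 2 2) N)

/-- **`HelpedDeg N B`** (problem-side definition): `⟨B⟩ ⊠ C₁^{⊠N} ⊵ ⟨2,2,2⟩^{⊠N}` as a degeneration
— a BORDER CERTIFICATE for the leaf at level `N` with `B` helpers. -/
def HelpedDeg (N B : ℕ) : Prop :=
  HelpedDegBy coupling₁ N B

/-- A restriction certificate is a border certificate: `Helped N B ⟹ HelpedDeg N B` (BCS (15.20)).
[cite: BurgisserClausenShokrollahi1997, (15.20)] -/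
theorem helpedDeg_of_helped {N B : ℕ} (h : Helped N B) : HelpedDeg N B :=
  h.algDegeneratesTo

/-- Mutual restriction from an identity in Strassen's semiring `T(ℂ)`. [cite: Zuiddam2018, §2.3] -/
theorem restrictsTo_of_mk_eq {ι' κ' μ' : Type} [Fintype ι'] [Fintype κ'] [Fintype μ']
    {s : ι → κ → μ → ℂ} {t : ι' → κ' → μ' → ℂ} (h : TensorClass.mk s = TensorClass.mk t) :
    TensorRestrictsTo t s :=
  (TensorClass.mk_eq_mk_iff.1 h).1

/-- The reassociation `⟨B B'⟩ ⊠ H^{⊠(M+N)} ≥ (⟨B⟩ ⊠ H^{⊠M}) ⊠ (⟨B'⟩ ⊠ H^{⊠N})` (an isomorphism in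
`T(ℂ)`). [cite: Zuiddam2018, §2.3] -/
theorem restrictsTo_split (H : ι → κ → μ → ℂ) (M N B B' : ℕ) :
    TensorRestrictsTo (kroneckerTensor (unitTensor ℂ (B * B')) (kroneckerPow H (M + N)))
      (kroneckerTensor (kroneckerTensor (unitTensor ℂ B) (kroneckerPow H M))
        (kroneckerTensor (unitTensor ℂ B') (kroneckerPow H N))) := by
  refine restrictsTo_of_mk_eq ?_
  simp only [← TensorClass.mk_mul_mk, ← TensorClass.mk_pow, ← TensorClass.natCast_eq_mk]
  push_cast
  ring

/-- The reassociation `t^{⊠M} ⊠ t^{⊠N} ≥ t^{⊠(M+N)}`. [cite: Zuiddam2018, §2.3] -/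
theorem restrictsTo_pow_add (t : ι → κ → μ → ℂ) (M N : ℕ) :
    TensorRestrictsTo (kroneckerTensor (kroneckerPow t M) (kroneckerPow t N))
      (kroneckerPow t (M + N)) := by
  refine restrictsTo_of_mk_eq ?_
  simp only [← TensorClass.mk_mul_mk, ← TensorClass.mk_pow]
  ring

/-- **Border certificates multiply**: `HelpedDeg M B → HelpedDeg N B' → HelpedDeg (M+N) (B B')`
(BCS (15.25): degenerations tensor). [cite: BurgisserClausenShokrollahi1997, (15.25)] -/
theorem helpedDegBy_mul {H : ι → κ → μ → ℂ} {M N B B' : ℕ} (h : HelpedDegBy H M B)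
    (h' : HelpedDegBy H N B') : HelpedDegBy H (M + N) (B * B') :=
  ((restrictsTo_split H M N B B').algDegeneratesTo_trans (h.kronecker h')).trans_restrictsTo
    (restrictsTo_pow_add _ M N)

/-- `HelpedDeg M B → HelpedDeg N B' → HelpedDeg (M + N) (B B')`. [cite: BurgisserClausenShokrollahi1997, (15.25)] -/
theorem helpedDeg_mul {M N B B' : ℕ} (h : HelpedDeg M B) (h' : HelpedDeg N B') :
    HelpedDeg (M + N) (B * B') :=
  helpedDegBy_mul h h'

/-- More helpers: `HelpedDegBy H N B → B ≤ B' → HelpedDegBy H N B'`. [cite: BurgisserClausenShokrollahi1997, (15.25)] -/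
theorem helpedDegBy_mono {H : ι → κ → μ → ℂ} [DecidableEq ι] [DecidableEq κ] [DecidableEq μ]
    {N B B' : ℕ} (h : HelpedDegBy H N B) (hB : B ≤ B') : HelpedDegBy H N B' :=
  ((tensorRestrictsTo_unitTensor_castLE (K := ℂ) hB).kronecker
    (TensorRestrictsTo.refl (kroneckerPow H N))).algDegeneratesTo_trans h

/-- `HelpedDeg N B → B ≤ B' → HelpedDeg N B'`. [cite: BurgisserClausenShokrollahi1997, (15.25)] -/
theorem helpedDeg_mono {N B B' : ℕ} (h : HelpedDeg N B) (hB : B ≤ B') : HelpedDeg N B' :=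
  helpedDegBy_mono h hB

/-- Powers: `HelpedDeg N B → HelpedDeg (k N) (B^k)`. [cite: BurgisserClausenShokrollahi1997, (15.25)] -/
theorem helpedDeg_pow {N B : ℕ} (h : HelpedDeg N B) (k : ℕ) : HelpedDeg (k * N) (B ^ k) := by
  induction k with
  | zero => simpa using helpedDeg_of_helped helped_zero_one
  | succ k ih =>
    have e₁ : (k + 1) * N = k * N + N := by ring
    rw [e₁, pow_succ]
    exact helpedDeg_mul ih h

/-- A better helper: `H' ≥ H` and `HelpedDegBy H N B` give `HelpedDegBy H' N B`. [cite: BurgisserClausenShokrollahi1997, (15.25)] -/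
theorem HelpedDegBy.of_restrictsTo {ι' κ' μ' : Type} [Fintype ι'] [Fintype κ'] [Fintype μ']
    {H : ι → κ → μ → ℂ} {H' : ι' → κ' → μ' → ℂ} {N B : ℕ} (hH : TensorRestrictsTo H' H)
    (h : HelpedDegBy H N B) : HelpedDegBy H' N B :=
  ((TensorRestrictsTo.refl (unitTensor ℂ B)).kronecker (hH.kroneckerPow N)).algDegeneratesTo_trans h

/-! ## 1. Border certificates bound every spectral point (degeneration monotonicity) -/

/-- **`HelpedDegBy H N B ⟹ F⟨2,2,2⟩^N ≤ B · F(H)^N`** at every universal spectral point: universal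
points are monotone under DEGENERATION (Strassen 1988, §3). [cite: Strassen1988, §3] -/
theorem pow_le_of_helpedDegBy {H : ι → κ → μ → ℂ} {N B : ℕ} (h : HelpedDegBy H N B)
    {F : SpectralMap ℂ} (hF : IsUniversalSpectralPoint ℂ F) :
    F (matMulTensor ℂ 2 2 2) ^ N ≤ (B : ℝ) * F H ^ N := by
  have hm := hF.mono_of_algDegeneratesTo h
  rwa [hF.map_kronecker, hF.map_kroneckerPow, hF.map_kroneckerPow, hF.map_unitTensor] at hm

/-- **`HelpedDeg N B ⟹ F⟨2,2,2⟩^N ≤ B · F(C₁)^N`** at every universal point — the border version of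
g21's `pow_le_of_helped`. [cite: Strassen1988, §3] -/
theorem pow_le_of_helpedDeg {N B : ℕ} (h : HelpedDeg N B) {F : SpectralMap ℂ}
    (hF : IsUniversalSpectralPoint ℂ F) :
    F (matMulTensor ℂ 2 2 2) ^ N ≤ (B : ℝ) * F coupling₁ ^ N :=
  pow_le_of_helpedDegBy h hF

/-- **A border certificate bounds the spectral ratio**: `HelpedDeg N B`, `B ≤ 2^{θN}`, `N ≥ 1` give
`F⟨2,2,2⟩ ≤ 2^θ F(C₁)` at every universal point. [cite: Strassen1988, Thm. 3.8] -/
theorem spectralRatioLe_of_helpedDeg {N B : ℕ} {θ : ℝ} (hN : 1 ≤ N) (h : HelpedDeg N B)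
    (hB : (B : ℝ) ≤ (2 : ℝ) ^ (θ * N)) : SpectralRatioLe θ := by
  intro F hF
  have ht0 : 0 ≤ F coupling₁ := hF.nonneg _
  have hm := pow_le_of_helpedDeg h hF
  have hN0 : N ≠ 0 := by omega
  have e2 : (2 : ℝ) ^ (θ * N) = ((2 : ℝ) ^ θ) ^ N := Real.rpow_mul_natCast (by norm_num) _ _
  rw [e2] at hB
  have hpow : F (matMulTensor ℂ 2 2 2) ^ N ≤ ((2 : ℝ) ^ θ * F coupling₁) ^ N :=
    calc F (matMulTensor ℂ 2 2 2) ^ N ≤ (B : ℝ) * F coupling₁ ^ N := hm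
      _ ≤ ((2 : ℝ) ^ θ) ^ N * F coupling₁ ^ N := mul_le_mul_of_nonneg_right hB (pow_nonneg ht0 N)
      _ = ((2 : ℝ) ^ θ * F coupling₁) ^ N := by rw [mul_pow]
  exact le_of_pow_le_pow_left₀ hN0 (by positivity) hpow

/-- **`HelpedDeg N B`, `B ≤ 2^{θN}`, `N ≥ 1` `⟹ θ⋆ ≤ θ`**: a border certificate pays exactly like a
restriction certificate. [cite: Strassen1988, Thm. 3.8] -/
theorem exchangeExponent_le_of_helpedDeg {N B : ℕ} {θ : ℝ} (hN : 1 ≤ N) (h : HelpedDeg N B)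
    (hB : (B : ℝ) ≤ (2 : ℝ) ^ (θ * N)) : exchangeExponent ≤ θ :=
  exchangeExponent_le_of_spectralRatioLe (spectralRatioLe_of_helpedDeg hN h hB)

/-- **`HelpedDeg N B ⟹ θ⋆ ≤ log₂ B / N`** (`N, B ≥ 1`). [cite: Strassen1988, Thm. 3.8] -/
theorem exchangeExponent_le_logb_div_of_helpedDeg {N B : ℕ} (hN : 1 ≤ N) (hB : 1 ≤ B)
    (h : HelpedDeg N B) : exchangeExponent ≤ Real.logb 2 B / N := by
  refine exchangeExponent_le_of_helpedDeg hN h (le_of_eq ?_)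
  have hN' : (N : ℝ) ≠ 0 := by exact_mod_cast (show N ≠ 0 by omega)
  have hB' : (0 : ℝ) < B := by exact_mod_cast hB
  rw [div_mul_cancel₀ _ hN', Real.rpow_logb (by norm_num) (by norm_num) hB']

/-- **`HelpedDeg N B ⟹ 2^{θ⋆N} ≤ B`**: the pointwise floor holds for border certificates too.
[cite: Strassen1988, Thm. 3.8] -/
theorem rpow_le_of_helpedDeg {N B : ℕ} (hN : 1 ≤ N) (h : HelpedDeg N B) :
    (2 : ℝ) ^ (exchangeExponent * N) ≤ B := by
  have hB : 1 ≤ B := le_trans (by norm_num) (two_le_of_helpedDeg_aux hN h)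
  · have hB' : (0 : ℝ) < B := by exact_mod_cast hB
    have hN' : (0 : ℝ) < N := by exact_mod_cast hN
    have hle := exchangeExponent_le_logb_div_of_helpedDeg hN hB h
    have hmul : exchangeExponent * N ≤ Real.logb 2 B := by
      rw [le_div_iff₀ hN'] at hle
      exact hle
    calc (2 : ℝ) ^ (exchangeExponent * N) ≤ (2 : ℝ) ^ Real.logb 2 (B : ℝ) :=
          Real.rpow_le_rpow_of_exponent_le (by norm_num) hmul
      _ = B := Real.rpow_logb (by norm_num) (by norm_num) hB'
where
  /-- `HelpedDeg N B ⟹ 2 ≤ B` for `N ≥ 1` (proved below as `two_le_of_helpedDeg`; local copy to keep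
  the section order). [cite: Blaser2013, Thm. 6.3] -/
  two_le_of_helpedDeg_aux {N B : ℕ} (hN : 1 ≤ N) (h : HelpedDeg N B) : 2 ≤ B := by
    by_contra hB
    push Not at hB
    interval_cases B
    · -- `B = 0`: `4^N = ζ⁽¹⁾(⟨2,2,2⟩^{⊠N}) ≤ 0`
      have hm := pow_le_of_helpedDeg h (gaugePoint₁_isUniversalSpectralPoint ℂ)
      rw [Nat.cast_zero, zero_mul, gaugePoint₁_eq, flatteningRank_matMul_two] at hm
      norm_num at hm
      exact absurd hm (not_le.2 (pow_pos (by norm_num) N))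
    · -- `B = 1`: lens-2's antichain `C₁^{⊠N} ⋭ ⟨2,2,2⟩^{⊠N}`
      have h1 : TensorRestrictsTo (kroneckerPow coupling₁ N)
          (kroneckerTensor (unitTensor ℂ 1) (kroneckerPow coupling₁ N)) := by
        refine restrictsTo_of_mk_eq ?_
        rw [← TensorClass.mk_mul_mk, ← TensorClass.natCast_eq_mk, Nat.cast_one, one_mul]
      exact FarEdgeDescentCouplingBridge.coupling₁_pow_not_algDegeneratesTo_matMul_pow N hN
        (h1.algDegeneratesTo_trans h)

/-- **No border certificate with fewer than two helpers** (`N ≥ 1`): `B = 0` is excluded by the first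
gauge point, `B = 1` by lens-2's antichain (`⟨2,2,2⟩^{⊠N}` is not even a degeneration of `C₁^{⊠N}`).
[cite: Blaser2013, Thm. 6.3] -/
theorem two_le_of_helpedDeg {N B : ℕ} (hN : 1 ≤ N) (h : HelpedDeg N B) : 2 ≤ B :=
  rpow_le_of_helpedDeg.two_le_of_helpedDeg_aux hN h

/-- `¬ HelpedDeg N 0` at every level (even `N = 0`: `ζ⁽¹⁾` gives `1 ≤ 0`). [cite: ChristandlVranaZuiddam2023, Example 1.4] -/
theorem not_helpedDeg_zero (N : ℕ) : ¬ HelpedDeg N 0 := by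
  intro h
  have hm := pow_le_of_helpedDeg h (gaugePoint₁_isUniversalSpectralPoint ℂ)
  rw [Nat.cast_zero, zero_mul, gaugePoint₁_eq, flatteningRank_matMul_two] at hm
  norm_num at hm
  exact absurd hm (not_le.2 (pow_pos (by norm_num) N))

/-! ## 2. The border exchange numbers `r̲(N)` -/

/-- **`r̲(N) := borderExchangeNumber N = min {B | ⟨B⟩ ⊠ C₁^{⊠N} ⊵ ⟨2,2,2⟩^{⊠N} (degeneration)}`**
(problem-side definition; census I69: no restriction at `(3,2)` found, one border-like valley). -/
def borderExchangeNumber (N : ℕ) : ℕ :=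
  sInf {B : ℕ | HelpedDeg N B}

/-- `r̲(N)` helpers do help (as a degeneration). [folklore] -/
theorem helpedDeg_borderExchangeNumber (N : ℕ) : HelpedDeg N (borderExchangeNumber N) :=
  Nat.sInf_mem (s := {B : ℕ | HelpedDeg N B}) ⟨2 ^ N, helpedDeg_of_helped (helped_pow_two_pow N)⟩

/-- `r̲(N) ≤ B` for every border certificate. [folklore] -/
theorem borderExchangeNumber_le {N B : ℕ} (h : HelpedDeg N B) : borderExchangeNumber N ≤ B :=
  Nat.sInf_le h

/-- `HelpedDeg N B ⟺ r̲(N) ≤ B`. [folklore] -/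
theorem helpedDeg_iff_borderExchangeNumber_le {N B : ℕ} :
    HelpedDeg N B ↔ borderExchangeNumber N ≤ B :=
  ⟨borderExchangeNumber_le, helpedDeg_mono (helpedDeg_borderExchangeNumber N)⟩

/-- **`r̲(N) ≤ r(N)`**: the border door is at least as wide. [cite: BurgisserClausenShokrollahi1997, (15.20)] -/
theorem borderExchangeNumber_le_exchangeNumber (N : ℕ) : borderExchangeNumber N ≤ exchangeNumber N :=
  borderExchangeNumber_le (helpedDeg_of_helped (helped_exchangeNumber N))

/-- `r̲(N) ≤ 2^N`. [folklore] -/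
theorem borderExchangeNumber_le_two_pow (N : ℕ) : borderExchangeNumber N ≤ 2 ^ N :=
  (borderExchangeNumber_le_exchangeNumber N).trans (exchangeNumber_le_two_pow N)

/-- **`2 ≤ r̲(N)`** for `N ≥ 1`. [cite: Blaser2013, Thm. 6.3] -/
theorem two_le_borderExchangeNumber {N : ℕ} (hN : 1 ≤ N) : 2 ≤ borderExchangeNumber N :=
  two_le_of_helpedDeg hN (helpedDeg_borderExchangeNumber N)

/-- `r̲(0) = 1`. [folklore] -/
theorem borderExchangeNumber_zero : borderExchangeNumber 0 = 1 := by
  refine le_antisymm ((borderExchangeNumber_le_exchangeNumber 0).trans (le_of_eq exchangeNumber_zero)) ?_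
  rcases Nat.eq_zero_or_pos (borderExchangeNumber 0) with h | h
  · have h0 := helpedDeg_borderExchangeNumber 0
    rw [h] at h0
    exact absurd h0 (not_helpedDeg_zero 0)
  · exact h

/-- **`r̲(1) = 2`** (`= r(1)`). [cite: Blaser2013, Thm. 6.3] -/
theorem borderExchangeNumber_one : borderExchangeNumber 1 = 2 :=
  le_antisymm ((borderExchangeNumber_le_exchangeNumber 1).trans (le_of_eq exchangeNumber_one))
    (two_le_borderExchangeNumber le_rfl)

/-- **`r̲(2) = 2`** (`= r(2)`): the border door opens nothing new below level `3`. [cite: Blaser2013, Thm. 6.3] -/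
theorem borderExchangeNumber_two : borderExchangeNumber 2 = 2 :=
  le_antisymm ((borderExchangeNumber_le_exchangeNumber 2).trans (le_of_eq exchangeNumber_two))
    (two_le_borderExchangeNumber (by norm_num))

/-- **Submultiplicativity `r̲(M + N) ≤ r̲(M) r̲(N)`.** [cite: BurgisserClausenShokrollahi1997, (15.25)] -/
theorem borderExchangeNumber_add_le (M N : ℕ) :
    borderExchangeNumber (M + N) ≤ borderExchangeNumber M * borderExchangeNumber N :=
  borderExchangeNumber_le (helpedDeg_mul (helpedDeg_borderExchangeNumber M)
    (helpedDeg_borderExchangeNumber N))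

/-- `r̲(k N) ≤ r̲(N)^k`. [cite: BurgisserClausenShokrollahi1997, (15.25)] -/
theorem borderExchangeNumber_mul_le (k N : ℕ) :
    borderExchangeNumber (k * N) ≤ borderExchangeNumber N ^ k :=
  borderExchangeNumber_le (helpedDeg_pow (helpedDeg_borderExchangeNumber N) k)

/-- **The pointwise floor for border certificates: `2^{θ⋆N} ≤ r̲(N)` for EVERY `N`.** So the sandwich
`2^{θ⋆N} ≤ r̲(N) ≤ r(N) ≤ 2^N` holds level by level, and `θ⋆ = inf_N log₂ r̲(N)/N` as well.
[cite: Strassen1988, Thm. 3.8] -/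
theorem rpow_le_borderExchangeNumber (N : ℕ) :
    (2 : ℝ) ^ (exchangeExponent * N) ≤ borderExchangeNumber N := by
  rcases Nat.eq_zero_or_pos N with rfl | hN
  · rw [borderExchangeNumber_zero]; norm_num
  · exact rpow_le_of_helpedDeg hN (helpedDeg_borderExchangeNumber N)

/-- **`θ⋆ ≤ log₂ r̲(N) / N`** for every `N ≥ 1`. [cite: Strassen1988, Thm. 3.8] -/
theorem exchangeExponent_le_logb_borderExchangeNumber_div {N : ℕ} (hN : 1 ≤ N) :
    exchangeExponent ≤ Real.logb 2 (borderExchangeNumber N) / N :=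
  exchangeExponent_le_logb_div_of_helpedDeg hN (le_trans (by norm_num) (two_le_borderExchangeNumber hN))
    (helpedDeg_borderExchangeNumber N)

/-- One border level with `r̲(N) < 2^{θN}` bounds the exchange exponent STRICTLY: `θ⋆ < θ`.
[cite: Strassen1988, Thm. 3.8] -/
theorem exchangeExponent_lt_of_borderLevel {N : ℕ} (hN : 1 ≤ N) {θ : ℝ}
    (h : (borderExchangeNumber N : ℝ) < (2 : ℝ) ^ (θ * N)) : exchangeExponent < θ := by
  have h1 := (rpow_le_borderExchangeNumber N).trans_lt h
  have hN' : (0 : ℝ) < N := by exact_mod_cast hN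
  have h2 := (Real.rpow_lt_rpow_left_iff (by norm_num : (1 : ℝ) < 2)).1 h1
  nlinarith

/-- **De-bordering in rate**: a border certificate at `(N,B)` yields RESTRICTION certificates at
every rate `θ > log₂B/N`, at ALL large levels (`θ⋆ ≤ log₂B/N`, then Strassen duality with rates,
tree `eventually_helped_of_exchangeExponent_lt`) — the border door costs nothing in rate.
[cite: Strassen1988, Thm. 3.8] -/
theorem eventually_helped_of_helpedDeg {N B : ℕ} (hN : 1 ≤ N) (hB : 1 ≤ B) (h : HelpedDeg N B)
    {θ : ℝ} (hθ : Real.logb 2 B / N < θ) :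
    ∃ N₀ : ℕ, ∀ N' : ℕ, N₀ ≤ N' → ∃ B' : ℕ, Helped N' B' ∧ (B' : ℝ) ≤ (2 : ℝ) ^ (θ * N') :=
  eventually_helped_of_exchangeExponent_lt
    ((exchangeExponent_le_logb_div_of_helpedDeg hN hB h).trans_lt hθ)

/-! ## 3. The leaf through the border door -/

/-- **`BlockOneIsMM ⟺ ∀ θ > 0, ∃ N ≥ 1, r̲(N) ≤ 2^{θN}`**: border certificates of every positive rate
are necessary (they are implied by restriction certificates) AND sufficient (each bounds `θ⋆`).
[cite: Strassen1988, Thm. 3.8] -/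
theorem blockOneIsMM_iff_borderExchangeNumber :
    Theses.OutsiderSandwich.BlockOneIsMM ↔
      ∀ θ : ℝ, 0 < θ → ∃ N : ℕ, 1 ≤ N ∧ (borderExchangeNumber N : ℝ) ≤ (2 : ℝ) ^ (θ * N) := by
  constructor
  · intro h θ hθ
    obtain ⟨N, hN, hle⟩ := (blockOneIsMM_iff_exchangeNumber.1 h) θ hθ
    exact ⟨N, hN, le_trans (by exact_mod_cast borderExchangeNumber_le_exchangeNumber N) hle⟩
  · intro h
    rw [blockOneIsMM_iff_exchangeExponent_eq_zero]
    refine le_antisymm (le_of_forall_pos_le_add fun θ hθ => ?_) exchangeExponent_nonneg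
    obtain ⟨N, hN, hle⟩ := h θ hθ
    rw [zero_add]
    exact exchangeExponent_le_of_helpedDeg hN (helpedDeg_borderExchangeNumber N) hle

/-- **`BlockOneIsMM ⟺` border certificates of every positive rate exist.** [cite: Strassen1988, Thm. 3.8] -/
theorem blockOneIsMM_iff_exists_borderCertificate :
    Theses.OutsiderSandwich.BlockOneIsMM ↔
      ∀ θ : ℝ, 0 < θ → ∃ N : ℕ, 1 ≤ N ∧ ∃ B : ℕ, HelpedDeg N B ∧ (B : ℝ) ≤ (2 : ℝ) ^ (θ * N) := by
  rw [blockOneIsMM_iff_borderExchangeNumber]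
  refine forall₂_congr fun θ _ => ⟨?_, ?_⟩
  · rintro ⟨N, hN, hle⟩
    exact ⟨N, hN, borderExchangeNumber N, helpedDeg_borderExchangeNumber N, hle⟩
  · rintro ⟨N, hN, B, hB, hle⟩
    exact ⟨N, hN, (Nat.cast_le.2 (borderExchangeNumber_le hB)).trans hle⟩

/-- **Bounded border exchange proves the leaf**: `(∀ N ≥ 1, HelpedDeg N C) ⟹ BlockOneIsMM`.
[cite: Strassen1988, Thm. 3.8] -/
theorem blockOneIsMM_of_border_bounded {C : ℕ} (h : ∀ N : ℕ, 1 ≤ N → HelpedDeg N C) :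
    Theses.OutsiderSandwich.BlockOneIsMM := by
  rw [blockOneIsMM_iff_exists_borderCertificate]
  intro θ hθ
  have hC2 : 2 ≤ C := two_le_of_helpedDeg le_rfl (h 1 le_rfl)
  have hC : (0 : ℝ) < C := by exact_mod_cast (by omega : 0 < C)
  obtain ⟨K, hK⟩ : ∃ K : ℕ, Real.logb 2 C / θ ≤ K := ⟨_, Nat.le_ceil _⟩
  set N : ℕ := max 1 K with hNdef
  refine ⟨N, le_max_left _ _, C, h N (le_max_left _ _), ?_⟩
  have hKN : (K : ℝ) ≤ N := by exact_mod_cast le_max_right _ _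
  have hK' : Real.logb 2 C ≤ K * θ := (div_le_iff₀ hθ).1 hK
  have hlog : Real.logb 2 C ≤ θ * N := by nlinarith
  calc (C : ℝ) = (2 : ℝ) ^ Real.logb 2 (C : ℝ) := (Real.rpow_logb (by norm_num) (by norm_num) hC).symm
    _ ≤ (2 : ℝ) ^ (θ * N) := Real.rpow_le_rpow_of_exponent_le (by norm_num) hlog

/-- In particular **`(∀ N ≥ 1, HelpedDeg N 2) ⟹ BlockOneIsMM`**. [cite: Strassen1988, Thm. 3.8] -/
theorem blockOneIsMM_of_forall_helpedDeg_two (h : ∀ N : ℕ, 1 ≤ N → HelpedDeg N 2) :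
    Theses.OutsiderSandwich.BlockOneIsMM :=
  blockOneIsMM_of_border_bounded h

/-- Contrapositive: a counterexample to the leaf makes even `r̲(N)` unbounded. [cite: Strassen1988, Thm. 3.8] -/
theorem borderExchangeNumber_unbounded_of_not_blockOneIsMM
    (h : ¬ Theses.OutsiderSandwich.BlockOneIsMM) (C : ℕ) :
    ∃ N : ℕ, 1 ≤ N ∧ C < borderExchangeNumber N := by
  by_contra hc
  push Not at hc
  exact h (blockOneIsMM_of_border_bounded fun N hN =>
    helpedDeg_mono (helpedDeg_borderExchangeNumber N) (hc N hN))

end Summit.MatrixMultiplication.MatrixMultiplication.Theorems.OutsiderSandwichBorderExchange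

end
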